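import Mathlib
import Summits.Ventures.FusionMHD.Models.CerfonFreidbergIterLikeQHalfResDefs
import HarnessLib

/-!
# Ventures/FusionMHD — Models/CerfonFreidbergIterLikeQHalfResPanels16.lean: KERNEL CHECK of the resistive-register certificates of panel(s) 28 (of 32)
# at `ψ_N = 1/2` of THE Cerfon–Freidberg ITER-like instance

HONEST FRAMING (LADDER-GRIDFUSION three columns; CF rung; rider «D_R at ψ_N = 1/2»).  One `decide +kernel` (≈ 60–90 s): for each listed panel the obligation
`CFIterLike.QHalfRes.ResCert.ok` (`Models/CerfonFreidbergIterLikeQHalfResDefs.lean`) — the Taylor-model run of `progR = progM ++ block3R` over ★ #117's parameter box is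
ACCEPTED and the kernel's two panel-integral enclosures (`g_AG`, `g_W` along the approximant) lie inside the claimed integers (compiled `#eval` of the same functions, slack
one unit of `2⁻⁶⁰`; float truth inside every panel, `genqm/truthR.json`).  MODELLED: analytic Cerfon–Freidberg family; nothing about a device or stability.
No `native_decide`.  Typer/prover: gridfusion-model-7 (g7), 2026-08-28.  Citations: Zheng 2015 §3.2 (3.42) [Zheng2015];
Mahboubi–Melquiond–Sibut-Pinote 2016 §3.2 Lemma 3 [MahboubiMelquiondSibutpinote2016].
-/

namespace Summit.Ventures.FusionMHD.Models.CFIterLike.QHalfRes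

/-- Resistive-register certificate data of panel(s) 28. [instance data] -/
def resCert16 : List ResCert := [
  { j := 28, cand1 := [870230536419482533888, -2377174170754471165952, 14045034956973810909184, -30661640444804245487616, 85311926874498649817088, -33908251535884375031808, -471745650697591500832768, 3580338208096376770789376, -15415341466166725296783360, 69166040443852190031806464, 965266818544096326543474688, -25689927559843119480698830848, -1555154971723839266239639715840],
    cand2 := [659518986534576586752, -1142938153962231037952, 6842187510114213167104, -16657240392774918864896, 60977906103331432955904, -145451973901217412677632, 373410781795684385292288, -566970526026039606378496, -451253854432774731071488, 19479394635244848155721728, 1552509250731096629540028416, -18681035708440029698916876288, -2242768593754136653049532252160],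
    deg := 10, e1 := 43, e2 := 43, glo := 4801673827642540, ghi := 4801673984037527, wlo := 182846084154099929, whi := 182846089483953124 }]

/-- **KERNEL CHECK** of the two resistive registers on panel(s) 28. -/
theorem resCert16_ok : CFIterLike.QHalfRes.resCert16.all ResCert.ok = true := by
  decide +kernel

end Summit.Ventures.FusionMHD.Models.CFIterLike.QHalfRes
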